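import Summits.BirchSwinnertonDyer.BirchSwinnertonDyer.Theses.PrintCf2
import Summits.BirchSwinnertonDyer.BirchSwinnertonDyer.Theorems.PrintCf2RamifiedOffTYZLowerHalfEvenWitness
import Summits.BirchSwinnertonDyer.BirchSwinnertonDyer.Theorems.PrintCf2RamifiedOffTYZLowerHalfVisibleSeven
import Summits.BirchSwinnertonDyer.BirchSwinnertonDyer.Theorems.PrintCf2RamifiedOffTYZSelmerRankOneSixOfFacts
import HarnessLib

/-!
# Item 23431 `PrintCf2.RamifiedJumpOneLevelTwoOfFacts` (C⁺) — THE LOWER HALF BY NAME: the line `cassels-tate-entries`' stub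
# `stub_TwoDividesScriptL` in its EXACT binder shape, granted the TYZ §3 displays + Thm. 1.1 + GZK and ONE non-silent rational point;
# its exact open residual = the silent-generator stratum (crux stmt-BirchSwinnertonDyer-20509 `RamifiedOffTYZOfFacts`, line `offtyz-v7`,
# LEAD cruxlead-20509 g24, lineage cycle 25)

HONEST FRAMING (cell `bsd-print-cf2`, route `PrintCf2`; `--supports stmt-BirchSwinnertonDyer-20509`; THEOREMS ONLY — no `def`, no named fact
introduced, no `sorry`; standard axioms).  BSD is not proved by any of this; item 23431 and crux 20509 stay OPEN.

WHY THIS FILE.  The crux-plan line `cassels-tate-entries` registered on C⁺ = item 23431 (2026-08-30T17:27Z) cuts C⁺ into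
`stub_TwoDividesScriptL` («`2 ∣ 𝓛(n)` on the jump-one class», sized «M, applying print: TYZ Thm 1.2 gives `2^{1+ρ(n)} ∣ 𝓛(n)`») and
`stub_NotFourDividesScriptL`.  Two corrections, recorded here as kernel statements:

1. **Tian–Yuan–Zhang's Thm. 1.2 is ONE-directional** (`2^{−ρ}𝓛(n)` even ⟹ genus sums even; tree `thm12_parity_of_scriptL'`), and the §3 displays
   (`thm35Main`: `2^{1+ρ} P(n) − 𝓛(n) α_n` torsion) give `2 ∣ 𝓛(n)` only where the point `α_n` (the generator side) is NOT `2`-divisible in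
   `A(ℍ′_n)` modulo torsion.  The lineage proved exactly this much: the lower half holds, GRANTED the displays + Thm. 1.1 + GZK, whenever `E_n(ℚ)`
   has a rational point with NON-SILENT abscissa — `x₀ ∉ {±1, ±n}·ℚ^{×2}` for odd `n` (⟺ `ρ(n) ≠ 0`; g15 `SpecialStratum.two_dvd_scriptL_odd_of_point_of_facts`),
   `x₀ ∉ ⟨−1, 2, n⟩·ℚ^{×2}` for even `n` (g14/g15 `…two_dvd_scriptL_even_allk_of_point_of_facts`), and on the block-free odd family also for
   `ρ(n) = 0` with a VISIBLE `A_n`-generator (g16 `LowerHalfVisible.two_dvd_scriptL_of_visible_of_facts`).  §2–§4 below restate these in the EXACT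
   binder shape of `stub_TwoDividesScriptL` (instance binders, `#Sel₂ = 2⁵`, `#Sel₄ = 2⁶`, `∀ L, IsScriptL n L → 2 ∣ L`) with the named-fact bundle
   `tyz_cmPointCompositumData ∧ thm11_parity_of_scriptL ∧ GZK` in front and ONE witness point added; §1 supplies the missing enumeration lemma
   «square-free `n ≡ 6 (8)` ⟹ `n = 2·p₁⋯p_k`, distinct odd primes, `∏pᵢ ≡ 3 (4)`» that turns the lineage's `Fin k`-indexed even theorems into
   `n`-quantified ones.
2. **The exact open residual of the lower half is the SILENT stratum** (§5, pure logic): `stub_TwoDividesScriptL` (granted the bundle) FOLLOWS from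
   the same statement restricted to the jump-one `n` ALL of whose rational points have silent abscissa (odd: `ρ(n) = 0`; the generator of
   `A_n(ℚ)` then has descent class `d(h) ≠ 1`, and on the block-free family the theorem of §4 leaves exactly `d(h) = 2`).  That stratum is
   POPULATED inside the jump-one class (R2 ∩ G census rows `n = 959, 4223, 7903, 7967, 8119, 9407`, all `d(h) = 2`, crux workfile
   `Lines/offtyz_v7_GenusPeriodBit.md`), and there `2 ∣ 𝓛(n)` is the `2`-DIVISIBILITY of the genus point `P(n)` in `A(ℍ′_n)` modulo torsion
   (g18 `InvisibleGenerator`: `[α_n] = 0`) — a Heegner-point statement of the same grade as the upper half, with no printed lever (TYZ stop at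
   `mod 2`, [corpus:paper:arxiv-1411.4728 Remark 1.3]).  So `stub_TwoDividesScriptL` is NOT «applying print»; and, being FACT-FREE as registered
   (no GZK, no TYZ display among its binders), it cannot be discharged by ANY display-conditional theorem of the lineage — §5's reduction and
   §2–§4 are the strongest by-name statements the tree supports today.
§6 records the dictionary «item 23431 ⟺ stub₁ ∧ stub₂» (the line's composition as an `Iff`).

References: [cite: TianYuanZhang2017, Thm. 1.1, Thm. 1.2, §1 (ρ(n), p0002 L101–L110), §3 (Prop. 3.4, Thm. 3.5, Lemma 3.18, Lemma 3.21), Remark 1.3];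
[cite: Darmon2004, Thm. 3.22] (GZK); [cite: SilvermanAEC2009, Prop. X.1.4, X.4.9]; [cite: HeathBrown1994SelmerCongruentII, Appendix (Monsky)];
tree: `…LowerHalfRhoDichotomy` (g15), `…LowerHalfEvenWitness` (g15), `…EvenOmegaIdentity` (g14), `…LowerHalfVisibleSeven` (g16),
`…SelmerRankOneSixOfFacts` (g10), `TianYuanZhang2017/CMPoint*Displays` (the display packages and their refinements).
-/

noncomputable section

open scoped Classical

open WeierstrassCurve WeierstrassCurve.Affine WeierstrassCurve.Affine.Point
  Literature.NumberTheory.EllipticCurves Literature.NumberTheory.EllipticCurves.TianYuanZhang2017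
  Summit.BirchSwinnertonDyer.BirchSwinnertonDyer.Theses.PrintCf2

set_option autoImplicit false

namespace Summit.BirchSwinnertonDyer.PrintCf2.LowerHalfByName

/-! ## §0 The named-fact bundle: `tyz_cmPointCompositumData` refines every earlier TYZ §3 display package -/

/-- The compositum-level package implies the two-conductor class-level one (drop the compositum sentence (C)).
[cite: TianYuanZhang2017, §3.1 (p0011 L58–L66), Prop. 3.2 (1)(2)] -/
theorem valueData₂_of_compositumData (h : tyz_cmPointCompositumData) : tyz_cmPointRingClassFrobeniusValueData₂ :=
  fun n hn h8 => by
    obtain ⟨D, hP, hC⟩ := h n hn h8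
    exact ⟨D, hP, hC.valuePrinted₂⟩

/-- The compositum-level package implies `tyz_cmPointRingClassFrobeniusValueData` (the hypothesis of the even lower-half theorems).
[cite: TianYuanZhang2017, §3.1–3.2, Prop. 3.2 (1)(2)] -/
theorem valueData_of_compositumData (h : tyz_cmPointCompositumData) : tyz_cmPointRingClassFrobeniusValueData :=
  tyz_cmPointRingClassFrobeniusValueData_of_value₂ (valueData₂_of_compositumData h)

/-- The compositum-level package implies `tyz_cmPointRingClassFrobeniusData` (the hypothesis of the odd lower-half theorems).
[cite: TianYuanZhang2017, §3.1–3.2, Prop. 3.2 (1)(2)] -/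
theorem frobeniusData_of_compositumData (h : tyz_cmPointCompositumData) : tyz_cmPointRingClassFrobeniusData :=
  MoverAssembly.tyz_cmPointRingClassFrobeniusData_of_four
    (tyz_cmPointRingClassFrobeniusFourData_of_value (valueData_of_compositumData h))

/-! ## §1 Square-free `n ≡ 6 (mod 8)` as `2·p₁⋯p_k` with distinct odd primes and `∏pᵢ ≡ 3 (mod 4)` -/

/-- **Enumeration lemma**: a square-free `n ≡ 6 (mod 8)` is `2·∏ᵢ pᵢ` for an injective family of odd primes `p : Fin k → ℕ` with
`∏ᵢ pᵢ ≡ 3 (mod 4)` (the indexing used by the lineage's «all `k`» even theorems). [folklore] -/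
theorem exists_fin_primes_of_squarefree_mod_eight_six {n : ℕ} (hsq : Squarefree n) (h6 : n % 8 = 6) :
    ∃ (k : ℕ) (p : Fin k → ℕ), (∀ i, (p i).Prime) ∧ (∀ i, Odd (p i)) ∧ Function.Injective p ∧
      n = 2 * ∏ i, p i ∧ (∏ i, p i) % 4 = 3 := by
  set m : ℕ := n / 2 with hm
  have hnm : n = 2 * m := by omega
  have hm4 : m % 4 = 3 := by omega
  have hmodd : Odd m := Nat.odd_iff.mpr (by omega)
  have hmsq : Squarefree m := Squarefree.squarefree_of_dvd (Dvd.intro_left 2 hnm.symm) hsq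
  set s : Finset ℕ := m.primeFactors with hs
  have hprod : ∏ i : Fin s.card, ((s.equivFin.symm i : s) : ℕ) = m := by
    have h1 : ∏ i : Fin s.card, ((s.equivFin.symm i : s) : ℕ) = ∏ x : s, (x : ℕ) :=
      Fintype.prod_equiv s.equivFin.symm _ _ (fun _ => rfl)
    rw [h1, Finset.prod_coe_sort s (fun x => x), hs, Nat.prod_primeFactors_of_squarefree hmsq]
  refine ⟨s.card, fun i => ((s.equivFin.symm i : s) : ℕ), fun i => ?_, fun i => ?_, fun i j hij => ?_, ?_, ?_⟩
  · exact Nat.prime_of_mem_primeFactors (s.equivFin.symm i).2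
  · exact hmodd.of_dvd_nat (Nat.dvd_of_mem_primeFactors (s.equivFin.symm i).2)
  · exact s.equivFin.symm.injective (Subtype.ext hij)
  · rw [hprod]; exact hnm
  · rw [hprod]; exact hm4

/-! ## §2 Odd residues `n ≡ 5, 7 (mod 8)`: the lower half from ONE point with abscissa outside `{±1, ±n}·ℚ^{×2}` (⟺ `ρ(n) ≠ 0`) -/

/-- **`stub_TwoDividesScriptL`, odd residues, granted the bundle and one non-silent point.**  For square-free `n ≡ 5, 7 (mod 8)` in the
jump-one class (`ord_{s=1} L(E_n, s) = 1`, `#Sel₂(E_n) = 2⁵`; the `#Sel₄` binder is not needed) and ANY rational point `(x₀, y₀) ∈ E_n(ℚ)` with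
`x₀ ∉ {1, −1, n, −n}·ℚ^{×2}`: `2 ∣ L` whenever `𝓛(n)² = L²`.  By name = g15's `SpecialStratum.two_dvd_scriptL_odd_of_point_of_facts` at `s = 3`.
[cite: TianYuanZhang2017, Thm. 1.1, §1 (ρ(n)), §3] [cite: Darmon2004, Thm. 3.22] -/
theorem twoDivides_odd_of_point_of_facts
    (hF : tyz_cmPointCompositumData ∧ thm11_parity_of_scriptL ∧ rank_eq_analyticRank_of_analyticRank_le_one)
    (n : ℕ) [(congruentNumberCurve n).IsElliptic]
    (hsq : Squarefree n) (h57 : n % 8 = 5 ∨ n % 8 = 7) (hr : (congruentNumberCurve n).analyticRank = 1)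
    (h2 : Nat.card ((congruentNumberCurve n).selmerGroup 2) = 2 ^ 5)
    {x₀ y₀ : ℚ} (h₀ : (congruentNumberCurve n).toAffine.Nonsingular x₀ y₀)
    (hx₀ : ¬ ∃ q : ℚ, x₀ = q ^ 2 ∨ x₀ = -q ^ 2 ∨ x₀ = n * q ^ 2 ∨ x₀ = -(n * q ^ 2)) :
    ∀ L : ℤ, IsScriptL n L → (2 : ℤ) ∣ L :=
  SpecialStratum.two_dvd_scriptL_odd_of_point_of_facts ⟨frobeniusData_of_compositumData hF.1, hF.2.1, hF.2.2⟩
    hsq h57 hr (s := 3) (by norm_num) h2 h₀ hx₀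

/-- **Generator-free odd form: `ρ(n) ≠ 0` suffices** (`2^{ρ(n)} = [E_n(ℚ) : φ_n(A_n(ℚ)) + E_n[2]]`, tree `(rhoSubgroup n).index`).  By name =
g15's `SpecialStratum.two_dvd_scriptL_odd_of_rhoIndex_ne_one_of_facts` at `s = 3`. [cite: TianYuanZhang2017, Thm. 1.1, §1 (ρ(n)), §3] [cite: Darmon2004, Thm. 3.22] -/
theorem twoDivides_odd_of_rhoIndex_ne_one_of_facts
    (hF : tyz_cmPointCompositumData ∧ thm11_parity_of_scriptL ∧ rank_eq_analyticRank_of_analyticRank_le_one)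
    (n : ℕ) [(congruentNumberCurve n).IsElliptic]
    (hsq : Squarefree n) (h57 : n % 8 = 5 ∨ n % 8 = 7) (hr : (congruentNumberCurve n).analyticRank = 1)
    (h2 : Nat.card ((congruentNumberCurve n).selmerGroup 2) = 2 ^ 5) (hρ : (rhoSubgroup n).index ≠ 1) :
    ∀ L : ℤ, IsScriptL n L → (2 : ℤ) ∣ L :=
  SpecialStratum.two_dvd_scriptL_odd_of_rhoIndex_ne_one_of_facts ⟨frobeniusData_of_compositumData hF.1, hF.2.1, hF.2.2⟩
    n hsq h57 hr 3 (by norm_num) h2 hρ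

/-! ## §3 Even residue `n ≡ 6 (mod 8)`: the lower half from ONE point with abscissa outside `⟨−1, 2, n⟩·ℚ^{×2}`, every number of prime factors -/

/-- **`stub_TwoDividesScriptL`, even residue, granted the bundle and one non-silent point.**  For square-free `n ≡ 6 (mod 8)` in the jump-one
class (`ord_{s=1} L(E_n, s) = 1`, `#Sel₂(E_n) = 2⁵`) and ANY rational point `(x₀, y₀) ∈ E_n(ℚ)` with `x₀ ∉ ⟨−1, 2, n⟩·ℚ^{×2}` (the two four-fold
exclusions): `2 ∣ L` whenever `𝓛(n)² = L²`.  By name = g14/g15's `SpecialStratum.two_dvd_scriptL_even_allk_of_point_of_facts` over the enumeration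
of §1. [cite: TianYuanZhang2017, Thm. 1.1, §3] [cite: Darmon2004, Thm. 3.22] [cite: SilvermanAEC2009, Prop. X.1.4] -/
theorem twoDivides_even_of_point_of_facts
    (hF : tyz_cmPointCompositumData ∧ thm11_parity_of_scriptL ∧ rank_eq_analyticRank_of_analyticRank_le_one)
    (n : ℕ) [(congruentNumberCurve n).IsElliptic]
    (hsq : Squarefree n) (h6 : n % 8 = 6) (hr : (congruentNumberCurve n).analyticRank = 1)
    (h2 : Nat.card ((congruentNumberCurve n).selmerGroup 2) = 2 ^ 5)
    {x₀ y₀ : ℚ} (h₀ : (congruentNumberCurve n).toAffine.Nonsingular x₀ y₀)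
    (hx₀ : ¬ ∃ q : ℚ, x₀ = q ^ 2 ∨ x₀ = -q ^ 2 ∨ x₀ = n * q ^ 2 ∨ x₀ = -(n * q ^ 2))
    (hx₀2 : ¬ ∃ q : ℚ, x₀ = 2 * q ^ 2 ∨ x₀ = -(2 * q ^ 2) ∨ x₀ = 2 * n * q ^ 2 ∨ x₀ = -(2 * n * q ^ 2)) :
    ∀ L : ℤ, IsScriptL n L → (2 : ℤ) ∣ L := by
  obtain ⟨k, p, hp, hodd, hinj, hn, h3⟩ := exists_fin_primes_of_squarefree_mod_eight_six hsq h6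
  exact SpecialStratum.two_dvd_scriptL_even_allk_of_point_of_facts p hp hodd hinj
    ⟨valueData_of_compositumData hF.1, hF.2.1, hF.2.2⟩ hn h3 hsq (s := 3) (by norm_num) h2 hr h₀ hx₀ hx₀2

/-! ## §4 Block-free odd family, `ρ(n) = 0`: the lower half from a VISIBLE generator of `A_n(ℚ)` (descent class `d(h) ∉ {1, 2}`) -/

/-- **`stub_TwoDividesScriptL` on the block-free family from a visible `A_n`-generator, granted the bundle.**  Square-free `n ≡ 7 (mod 8)` with NO
divisor `≡ 5 (mod 8)`, `ord_{s=1} L(E_n, s) = 1`, and a generator `h = (X, Y)` of `A_n(ℚ)` modulo torsion (`A_n = (congruentNumberCurve n).twoIsogenyCodomain :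
Y² = X³ + 4n²X`) with `X ∉ ℚ^{×2} ∪ 2ℚ^{×2}`: `2 ∣ L` whenever `𝓛(n)² = L²` (no Selmer binder needed).  By name = g16's
`LowerHalfVisible.two_dvd_scriptL_of_visible_of_facts'`.  Together with §2 this leaves, on that family, exactly the INVISIBLE class `d(h) = 2`.
[cite: TianYuanZhang2017, §1 (p0002 L101–L110), §3.1 (p0011 L58–L66), Thm. 3.5, Lemma 3.18] [cite: Darmon2004, Thm. 3.22] -/
theorem twoDivides_seven_blockFree_of_visible_of_facts
    (hF : tyz_cmPointCompositumData ∧ thm11_parity_of_scriptL ∧ rank_eq_analyticRank_of_analyticRank_le_one)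
    (n : ℕ) [(congruentNumberCurve n).IsElliptic]
    (hsq : Squarefree n) (h7 : n % 8 = 7) (hnb : ∀ d ∈ n.divisors, d % 8 ≠ 5) (hr : (congruentNumberCurve n).analyticRank = 1)
    {X Y : ℚ} (h : ((congruentNumberCurve n).twoIsogenyCodomain).toAffine.Nonsingular X Y)
    (hgen : ∀ P, ∃ m : ℤ, IsOfFinAddOrder (P - m • (Point.some X Y h : ((congruentNumberCurve n).twoIsogenyCodomain).toAffine.Point)))
    (hX : ¬ ∃ q : ℚ, X = q ^ 2 ∨ X = 2 * q ^ 2) :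
    ∀ L : ℤ, IsScriptL n L → (2 : ℤ) ∣ L :=
  LowerHalfVisible.two_dvd_scriptL_of_visible_of_facts' hF.1 hF.2.2 hsq h7 hnb hr h hgen hX

/-! ## §5 All residues: the stub in its exact binder shape, plus the bundle, plus ONE non-silent point; and the reduction to the silent stratum -/

/-- **`stub_TwoDividesScriptL` FROM ONE NON-SILENT POINT, all residues `5, 6, 7`, every number of prime factors, granted
`tyz_cmPointCompositumData ∧ thm11_parity_of_scriptL ∧ GZK`.**  The binders after the bundle are VERBATIM those of the registered stub (the `#Sel₄`
binder is carried and unused); the one extra hypothesis is a rational point `(x₀, y₀) ∈ E_n(ℚ)` with `x₀ ∉ ⟨−1, 2, n⟩·ℚ^{×2}` («non-silent»).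
[cite: TianYuanZhang2017, Thm. 1.1, §1 (ρ(n)), §3] [cite: Darmon2004, Thm. 3.22] [cite: SilvermanAEC2009, Prop. X.1.4] -/
theorem twoDivides_of_point_of_facts
    (hF : tyz_cmPointCompositumData ∧ thm11_parity_of_scriptL ∧ rank_eq_analyticRank_of_analyticRank_le_one)
    (n : ℕ) [(congruentNumberCurve n).IsElliptic] [(congruentNumberCurve n).IsGloballyMinimal]
    (hsq : Squarefree n) (h567 : n % 8 = 5 ∨ n % 8 = 6 ∨ n % 8 = 7) (hr : (congruentNumberCurve n).analyticRank = 1)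
    (h2 : Nat.card ((congruentNumberCurve n).selmerGroup 2) = 2 ^ 5)
    (_h4 : Nat.card ((congruentNumberCurve n).selmerGroup 4) = 2 ^ 6)
    {x₀ y₀ : ℚ} (h₀ : (congruentNumberCurve n).toAffine.Nonsingular x₀ y₀)
    (hx₀ : ¬ ∃ q : ℚ, x₀ = q ^ 2 ∨ x₀ = -q ^ 2 ∨ x₀ = n * q ^ 2 ∨ x₀ = -(n * q ^ 2) ∨
        x₀ = 2 * q ^ 2 ∨ x₀ = -(2 * q ^ 2) ∨ x₀ = 2 * n * q ^ 2 ∨ x₀ = -(2 * n * q ^ 2)) :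
    ∀ L : ℤ, IsScriptL n L → (2 : ℤ) ∣ L := by
  have hx₁ : ¬ ∃ q : ℚ, x₀ = q ^ 2 ∨ x₀ = -q ^ 2 ∨ x₀ = n * q ^ 2 ∨ x₀ = -(n * q ^ 2) := by
    rintro ⟨q, hq⟩
    exact hx₀ ⟨q, by tauto⟩
  have hx₂ : ¬ ∃ q : ℚ, x₀ = 2 * q ^ 2 ∨ x₀ = -(2 * q ^ 2) ∨ x₀ = 2 * n * q ^ 2 ∨ x₀ = -(2 * n * q ^ 2) := by
    rintro ⟨q, hq⟩
    exact hx₀ ⟨q, by tauto⟩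
  rcases h567 with h5 | h6 | h7
  · exact twoDivides_odd_of_point_of_facts hF n hsq (Or.inl h5) hr h2 h₀ hx₁
  · exact twoDivides_even_of_point_of_facts hF n hsq h6 hr h2 h₀ hx₁ hx₂
  · exact twoDivides_odd_of_point_of_facts hF n hsq (Or.inr h7) hr h2 h₀ hx₁

/-- **THE EXACT OPEN RESIDUAL OF THE LOWER HALF IS THE SILENT STRATUM** (pure logic with the previous theorem).  Granted the bundle, the text of
`stub_TwoDividesScriptL` (= the conclusion, VERBATIM) follows from the same text restricted to the jump-one `n` all of whose rational points have
abscissa in `⟨−1, 2, n⟩·ℚ^{×2}` (the hypothesis `hSilent`; by GZK the class has rank one, so this says: the generator modulo torsion is silent —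
odd `n`: `ρ(n) = 0`).  Nothing is asserted about `hSilent`: it is the research statement «`2 ∣ 𝓛(n)` on the silent stratum», i.e. the
`2`-divisibility of TYZ's genus point `P(n)` in `A(ℍ′_n)` modulo torsion there (g18 `InvisibleGenerator`), for which print has no lever.
[cite: TianYuanZhang2017, Thm. 1.1, Thm. 3.5, Remark 1.3] [cite: Darmon2004, Thm. 3.22] -/
theorem twoDivides_of_facts_of_silentStratum
    (hF : tyz_cmPointCompositumData ∧ thm11_parity_of_scriptL ∧ rank_eq_analyticRank_of_analyticRank_le_one)
    (hSilent : ∀ (n : ℕ) [(congruentNumberCurve n).IsElliptic] [(congruentNumberCurve n).IsGloballyMinimal],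
      Squarefree n → (n % 8 = 5 ∨ n % 8 = 6 ∨ n % 8 = 7) → (congruentNumberCurve n).analyticRank = 1 →
      Nat.card ((congruentNumberCurve n).selmerGroup 2) = 2 ^ 5 → Nat.card ((congruentNumberCurve n).selmerGroup 4) = 2 ^ 6 →
      (∀ x₀ y₀ : ℚ, (congruentNumberCurve n).toAffine.Nonsingular x₀ y₀ →
        ∃ q : ℚ, x₀ = q ^ 2 ∨ x₀ = -q ^ 2 ∨ x₀ = n * q ^ 2 ∨ x₀ = -(n * q ^ 2) ∨
          x₀ = 2 * q ^ 2 ∨ x₀ = -(2 * q ^ 2) ∨ x₀ = 2 * n * q ^ 2 ∨ x₀ = -(2 * n * q ^ 2)) →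
      ∀ L : ℤ, IsScriptL n L → (2 : ℤ) ∣ L) :
    ∀ (n : ℕ) [(congruentNumberCurve n).IsElliptic] [(congruentNumberCurve n).IsGloballyMinimal],
      Squarefree n → (n % 8 = 5 ∨ n % 8 = 6 ∨ n % 8 = 7) → (congruentNumberCurve n).analyticRank = 1 →
      Nat.card ((congruentNumberCurve n).selmerGroup 2) = 2 ^ 5 → Nat.card ((congruentNumberCurve n).selmerGroup 4) = 2 ^ 6 →
      ∀ L : ℤ, IsScriptL n L → (2 : ℤ) ∣ L := by
  intro n _ _ hsq h567 hr h2 h4 L hL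
  by_cases hex : ∃ x₀ y₀ : ℚ, ∃ _ : (congruentNumberCurve n).toAffine.Nonsingular x₀ y₀,
      ¬ ∃ q : ℚ, x₀ = q ^ 2 ∨ x₀ = -q ^ 2 ∨ x₀ = n * q ^ 2 ∨ x₀ = -(n * q ^ 2) ∨
        x₀ = 2 * q ^ 2 ∨ x₀ = -(2 * q ^ 2) ∨ x₀ = 2 * n * q ^ 2 ∨ x₀ = -(2 * n * q ^ 2)
  · obtain ⟨x₀, y₀, h₀, hx₀⟩ := hex
    exact twoDivides_of_point_of_facts hF n hsq h567 hr h2 h4 h₀ hx₀ L hL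
  · push Not at hex
    exact hSilent n hsq h567 hr h2 h4 (fun x₀ y₀ h₀ => hex x₀ y₀ h₀) L hL

/-- **Odd residues: the residual in TYZ's own currency is `ρ(n) = 0`** (pure logic with §2's generator-free form): granted the bundle, the ODD part
of `stub_TwoDividesScriptL` follows from the same text on the stratum `[E_n(ℚ) : φ_n(A_n(ℚ)) + E_n[2]] = 1`.
[cite: TianYuanZhang2017, §1 (ρ(n), p0002 L101–L110), Thm. 1.1, §3] [cite: Darmon2004, Thm. 3.22] -/
theorem twoDivides_odd_of_facts_of_rhoZero
    (hF : tyz_cmPointCompositumData ∧ thm11_parity_of_scriptL ∧ rank_eq_analyticRank_of_analyticRank_le_one)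
    (hZero : ∀ (n : ℕ) [(congruentNumberCurve n).IsElliptic] [(congruentNumberCurve n).IsGloballyMinimal],
      Squarefree n → (n % 8 = 5 ∨ n % 8 = 7) → (congruentNumberCurve n).analyticRank = 1 →
      Nat.card ((congruentNumberCurve n).selmerGroup 2) = 2 ^ 5 → Nat.card ((congruentNumberCurve n).selmerGroup 4) = 2 ^ 6 →
      (rhoSubgroup n).index = 1 → ∀ L : ℤ, IsScriptL n L → (2 : ℤ) ∣ L) :
    ∀ (n : ℕ) [(congruentNumberCurve n).IsElliptic] [(congruentNumberCurve n).IsGloballyMinimal],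
      Squarefree n → (n % 8 = 5 ∨ n % 8 = 7) → (congruentNumberCurve n).analyticRank = 1 →
      Nat.card ((congruentNumberCurve n).selmerGroup 2) = 2 ^ 5 → Nat.card ((congruentNumberCurve n).selmerGroup 4) = 2 ^ 6 →
      ∀ L : ℤ, IsScriptL n L → (2 : ℤ) ∣ L := by
  intro n _ _ hsq h57 hr h2 h4 L hL
  by_cases hρ : (rhoSubgroup n).index = 1
  · exact hZero n hsq h57 hr h2 h4 hρ L hL
  · exact twoDivides_odd_of_rhoIndex_ne_one_of_facts hF n hsq h57 hr h2 hρ L hL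

/-! ## §6 The dictionary with item 23431: the line's two stubs are exactly the two halves -/

/-- **Item 23431 ⟺ (lower half) ∧ (upper half)** — the composition of the line `cassels-tate-entries` as an `Iff` (its two registered stubs
`stub_TwoDividesScriptL`, `stub_NotFourDividesScriptL` are VERBATIM the two conjuncts). [cite: TianYuanZhang2017, Thm. 1.2 (𝓛(n) ∈ ℤ)] -/
theorem ramifiedJumpOneLevelTwoOfFacts_iff_halves :
    RamifiedJumpOneLevelTwoOfFacts ↔
      ((∀ (n : ℕ) [(congruentNumberCurve n).IsElliptic] [(congruentNumberCurve n).IsGloballyMinimal],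
        Squarefree n → (n % 8 = 5 ∨ n % 8 = 6 ∨ n % 8 = 7) → (congruentNumberCurve n).analyticRank = 1 →
        Nat.card ((congruentNumberCurve n).selmerGroup 2) = 2 ^ 5 → Nat.card ((congruentNumberCurve n).selmerGroup 4) = 2 ^ 6 →
        ∀ L : ℤ, IsScriptL n L → (2 : ℤ) ∣ L) ∧
      (∀ (n : ℕ) [(congruentNumberCurve n).IsElliptic] [(congruentNumberCurve n).IsGloballyMinimal],
        Squarefree n → (n % 8 = 5 ∨ n % 8 = 6 ∨ n % 8 = 7) → (congruentNumberCurve n).analyticRank = 1 →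
        Nat.card ((congruentNumberCurve n).selmerGroup 2) = 2 ^ 5 → Nat.card ((congruentNumberCurve n).selmerGroup 4) = 2 ^ 6 →
        ∀ L : ℤ, IsScriptL n L → ¬ (4 : ℤ) ∣ L)) := by
  constructor
  · intro h
    exact ⟨fun n _ _ hsq h8 hr h2 h4 L hL => (h n hsq h8 hr h2 h4 L hL).1,
      fun n _ _ hsq h8 hr h2 h4 L hL => (h n hsq h8 hr h2 h4 L hL).2⟩
  · rintro ⟨hlow, hup⟩ n _ _ hsq h8 hr h2 h4 L hL
    exact ⟨hlow n hsq h8 hr h2 h4 L hL, hup n hsq h8 hr h2 h4 L hL⟩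

/-- **Granted the bundle and the silent-stratum statement, item 23431 reduces to its upper half** (`stub_NotFourDividesScriptL`).
[cite: TianYuanZhang2017, Thm. 1.1, Thm. 3.5] [cite: Darmon2004, Thm. 3.22] -/
theorem ramifiedJumpOneLevelTwoOfFacts_of_facts_of_silentStratum_of_upper
    (hF : tyz_cmPointCompositumData ∧ thm11_parity_of_scriptL ∧ rank_eq_analyticRank_of_analyticRank_le_one)
    (hSilent : ∀ (n : ℕ) [(congruentNumberCurve n).IsElliptic] [(congruentNumberCurve n).IsGloballyMinimal],
      Squarefree n → (n % 8 = 5 ∨ n % 8 = 6 ∨ n % 8 = 7) → (congruentNumberCurve n).analyticRank = 1 →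
      Nat.card ((congruentNumberCurve n).selmerGroup 2) = 2 ^ 5 → Nat.card ((congruentNumberCurve n).selmerGroup 4) = 2 ^ 6 →
      (∀ x₀ y₀ : ℚ, (congruentNumberCurve n).toAffine.Nonsingular x₀ y₀ →
        ∃ q : ℚ, x₀ = q ^ 2 ∨ x₀ = -q ^ 2 ∨ x₀ = n * q ^ 2 ∨ x₀ = -(n * q ^ 2) ∨
          x₀ = 2 * q ^ 2 ∨ x₀ = -(2 * q ^ 2) ∨ x₀ = 2 * n * q ^ 2 ∨ x₀ = -(2 * n * q ^ 2)) →
      ∀ L : ℤ, IsScriptL n L → (2 : ℤ) ∣ L)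
    (hUpper : ∀ (n : ℕ) [(congruentNumberCurve n).IsElliptic] [(congruentNumberCurve n).IsGloballyMinimal],
      Squarefree n → (n % 8 = 5 ∨ n % 8 = 6 ∨ n % 8 = 7) → (congruentNumberCurve n).analyticRank = 1 →
      Nat.card ((congruentNumberCurve n).selmerGroup 2) = 2 ^ 5 → Nat.card ((congruentNumberCurve n).selmerGroup 4) = 2 ^ 6 →
      ∀ L : ℤ, IsScriptL n L → ¬ (4 : ℤ) ∣ L) :
    RamifiedJumpOneLevelTwoOfFacts :=
  ramifiedJumpOneLevelTwoOfFacts_iff_halves.mpr ⟨twoDivides_of_facts_of_silentStratum hF hSilent, hUpper⟩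

end Summit.BirchSwinnertonDyer.PrintCf2.LowerHalfByName

end
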